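import Mathlib
import HarnessLib
import Summits.HubbardSuperconductivity.HubbardSuperconductivity.Theorems.KLProgrammeKLRegimeSplitLegCount

/-!
# Route `KLProgramme` — crux K3 split, ENGINE child `KLRegimeEngineV7`/`V8` (stmt-HubbardSuperconductivity-19662 / gen 3): the SLICE
# COVARIANCE ON A LEG — entrywise bounds of the zero-seed single-slice covariance `C^K_{>Λ_n} − C^K_{>Λ_{n−1}}` the one-step expansion
# integrates: `‖entry‖ ≤ βL²·(|Δw(k_X)|/t(k_X) + |Δw(k_Y)|/t(k_Y)) ≤ 4βL²/Λ_n`, and `0` unless a leg's weight changes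
# (cell gate-hubbard-kl, seat hubbard-kl-k3c2-p3, row «leg-dress bar»; complements `…SplitLegCount` §3b and `…SplitLegVertex`)

The (D) leg-dressing factor of an external leg `ℓ` at step `n` is `ζ_n(ℓ) = g_n(ℓ)·W₂^{(n−1)}(ℓ)` with `g_n` the slice covariance entry on the
two charge labels of the mode `ℓ = (k, σ)`.  `…SplitLegVertex` bounds `W₂^{(n−1)}` from the history slots; `…SplitLegCount` shows the slice
weight `Δw_n(k) = χ₂(t²/Λ_n²) − χ₂(t²/Λ²_{n−1})`, `t(k)² = ω² + e_K(k⃗)²`, vanishes off `Λ_n/2 < t < Λ_{n−1}` and that `1/t < 2/Λ_n` on it.  THIS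
module closes the loop at the level of the tree's covariance matrices (`hubbardCovSliceCT`, `hubbardCovarianceCT`, `nambuTwoPointCT`,
`nambuPropagatorCT`, zero seed `h = 0`, any frame `K`, any `β > 0`):
* `klFreqRadius … k = √(ω(k)² + e_K(k⃗)²)` (= `klLegRadius` at `±ω₀`), positive, even under `k ↦ −k` and under the Nambu relabelling;
* `klld_norm_nambuPropagatorCT_zero_seed_le`: every entry of `G_K(k)` at `h = 0` has norm `≤ 1/t(k)` (diagonal `= 1/t`, off-diagonal `0`);
* `klld_norm_nambuTwoPointCT_zero_seed_le(_snd)`: `‖⟨Ψ⁻Ψ⁺⟩‖ ≤ βL²/t` read at EITHER label (the table is momentum-diagonal);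
* `klld_norm_hubbardTwoPointCT_zero_seed_le`: `‖⟨ψ_X ψ_Y⟩₀^K‖ ≤ 2βL²·min-type bound `≤ 2βL²/t(k_X)` and `≤ 2βL²/t(k_Y)`;
* `klld_norm_covSliceCT_zero_seed_le`: `‖(C^K_{>Λ} − C^K_{>Λ'})(X,Y)‖ ≤ βL²·(|Δw(k_X)|/t(k_X) + |Δw(k_Y)|/t(k_Y))`;
* `klld_norm_covSliceCT_klScale_le`: between consecutive KL scales (`n ≥ 1` not needed) `≤ 4βL²/Λ_n`, and (with `…LegCount` §3b) the entry
  vanishes unless the weight of `X` or of `Y` changes — at `±ω₀` exactly the legs counted by `legSliceCountT … n` (`klld_counted_of_weight_ne`).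
The `βL²` is BGM's momentum-space normalisation `⟨ψ̂⁻_k ψ̂⁺_k⟩ = βL² ĝ(k)` ((2.3)); it cancels against the `(βL²)^{-1}` per momentum sum of
the kernels (`hubbardPlaneWave` conventions) inside any expansion.  Pure algebra on the tree's definitions; nothing about the model beyond
its free covariance is asserted.
-/

noncomputable section

namespace Summit.HubbardSuperconductivity.HubbardSuperconductivity.Theorems.KLRegimeSplit

set_option linter.dupNamespace false -- summit = problem name (single-conjunct summit), D-0017

open Real Finset Literature.MathematicalPhysics.QuantumLattice Literature.Probability.LatticeModels
open Summit.HubbardSuperconductivity.HubbardSuperconductivity.Theorems.KLProgrammeLegKernels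

section Model

variable (L M : ℕ)

/-! ## §1 The reading radius of a frequency–momentum label -/

/-- **The reading radius of a frequency–momentum label** in the frame `K`: `t(k) = √(ω(k)² + e_K(k⃗)²)` — the quantity Salmhofer's cutoff
compares with `Λ²`, and the inverse modulus of the free propagator `1/(−iω + e_K)`. -/
def klFreqRadius (β μ : ℝ) (K : TrigPolyC4v) (k : FreqMomentum L M) : ℝ :=
  Real.sqrt (matsubaraFreq β M k.1 ^ 2 + nambuXiCT L μ K k.2 ^ 2)

variable {L M}

/-- `t(k) > 0` (fermionic Matsubara frequencies do not vanish, `β ≠ 0`). -/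
theorem klFreqRadius_pos {β : ℝ} (hβ : β ≠ 0) (μ : ℝ) (K : TrigPolyC4v) (k : FreqMomentum L M) :
    0 < klFreqRadius L M β μ K k := by
  unfold klFreqRadius
  have hω := matsubaraFreq_ne_zero (M := M) hβ k.1
  have : 0 < matsubaraFreq β M k.1 ^ 2 := by positivity
  exact Real.sqrt_pos.mpr (by positivity)

/-- `t(k)² = ω² + e_K²`. -/
theorem klFreqRadius_sq (β μ : ℝ) (K : TrigPolyC4v) (k : FreqMomentum L M) :
    klFreqRadius L M β μ K k ^ 2 = matsubaraFreq β M k.1 ^ 2 + nambuXiCT L μ K k.2 ^ 2 :=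
  Real.sq_sqrt (by positivity)

/-- The cutoff weight above `Λ` reads the reading radius: `w^K_Λ(k) = χ₂(t(k)²/Λ²)`. -/
theorem klld_weight_eq_salmhofer_radius (β μ : ℝ) (K : TrigPolyC4v) (Λ : ℝ) (k : FreqMomentum L M) :
    hubbardCutoffWeightCT L M β μ K Λ k = salmhoferCutoff (klFreqRadius L M β μ K k ^ 2 / Λ ^ 2) := by
  rw [hubbardCutoffWeightCT, klFreqRadius_sq]

/-- `t(−k) = t(k)` (`ω ↦ −ω`, `e_K` even). -/
theorem klFreqRadius_neg [NeZero L] (β μ : ℝ) (K : TrigPolyC4v) (k : FreqMomentum L M) :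
    klFreqRadius L M β μ K k.neg = klFreqRadius L M β μ K k := by
  simp only [klFreqRadius, FreqMomentum.neg, matsubaraFreq_rev, neg_sq, nambuXiCT_neg]

/-- The Nambu relabelling preserves the reading radius. -/
theorem klFreqRadius_toNambu [NeZero L] (β μ : ℝ) (K : TrigPolyC4v) (X : HubbardFieldIdx L M) :
    klFreqRadius L M β μ K (toNambu X).1.1 = klFreqRadius L M β μ K X.1.1 := by
  unfold toNambu
  split_ifs
  · rfl
  · exact klFreqRadius_neg β μ K X.1.1

/-- At the lowest Matsubara frequency the reading radius is `…SplitLegCount`'s `klLegRadius`. -/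
theorem klFreqRadius_omega0 [NeZero M] (β μ : ℝ) (K : TrigPolyC4v) (k : TorusSite 2 L) :
    klFreqRadius L M β μ K (omega0 M, k) = klLegRadius L β μ K k := by
  rw [klFreqRadius, klLegRadius, matsubaraFreq_omega0]

/-- The same at `−ω₀`. -/
theorem klFreqRadius_omega0_rev [NeZero M] (β μ : ℝ) (K : TrigPolyC4v) (k : TorusSite 2 L) :
    klFreqRadius L M β μ K ((omega0 M).rev, k) = klLegRadius L β μ K k := by
  rw [klFreqRadius, klLegRadius, matsubaraFreq_omega0_rev, neg_sq]

/-! ## §2 The zero-seed propagator and two-point tables, entrywise -/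

/-- `‖(±e + iω)/(ω² + e²)‖ = 1/√(ω² + e²)`: the norm of a diagonal entry of the zero-seed Nambu propagator. -/
theorem klld_norm_lin_div_den {ω e : ℝ} (h : 0 < ω ^ 2 + e ^ 2) :
    ‖(Complex.I * ω + e) / ((ω ^ 2 + e ^ 2 : ℝ) : ℂ)‖ = (Real.sqrt (ω ^ 2 + e ^ 2))⁻¹ ∧
      ‖(Complex.I * ω - e) / ((ω ^ 2 + e ^ 2 : ℝ) : ℂ)‖ = (Real.sqrt (ω ^ 2 + e ^ 2))⁻¹ := by
  have hnum : ‖(Complex.I * ω + e : ℂ)‖ = Real.sqrt (ω ^ 2 + e ^ 2) := by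
    rw [Complex.norm_def, Complex.normSq_apply]
    congr 1
    simp; ring
  have hnum' : ‖(Complex.I * ω - e : ℂ)‖ = Real.sqrt (ω ^ 2 + e ^ 2) := by
    rw [Complex.norm_def, Complex.normSq_apply]
    congr 1
    simp; ring
  have hden : ‖((ω ^ 2 + e ^ 2 : ℝ) : ℂ)‖ = ω ^ 2 + e ^ 2 := by
    rw [Complex.norm_real, Real.norm_eq_abs, abs_of_pos h]
  have hs : Real.sqrt (ω ^ 2 + e ^ 2) / (ω ^ 2 + e ^ 2) = (Real.sqrt (ω ^ 2 + e ^ 2))⁻¹ := by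
    rw [Real.sqrt_div_self', one_div]
  refine ⟨?_, ?_⟩
  · rw [norm_div, hnum, hden, hs]
  · rw [norm_div, hnum', hden, hs]

/-- **Every entry of the zero-seed CT Nambu propagator has norm `≤ 1/t(k)`** (diagonal entries `(iω ± e_K)/(ω² + e_K²)` have norm exactly
`1/t`, off-diagonal ones vanish without seed). -/
theorem klld_norm_nambuPropagatorCT_zero_seed_le {β : ℝ} (hβ : β ≠ 0) (μ : ℝ) (K : TrigPolyC4v) (k : FreqMomentum L M)
    (a b : Fin 2) : ‖nambuPropagatorCT L M β μ 0 K k a b‖ ≤ (klFreqRadius L M β μ K k)⁻¹ := by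
  have hω := matsubaraFreq_ne_zero (M := M) hβ k.1
  have hpos : 0 < matsubaraFreq β M k.1 ^ 2 + nambuXiCT L μ K k.2 ^ 2 := by
    have : 0 < matsubaraFreq β M k.1 ^ 2 := by positivity
    positivity
  have hden : nambuDenCT L M β μ 0 K k = matsubaraFreq β M k.1 ^ 2 + nambuXiCT L μ K k.2 ^ 2 := by
    simp [nambuDenCT]
  obtain ⟨h00, h11⟩ := klld_norm_lin_div_den hpos
  have hinv : 0 ≤ (klFreqRadius L M β μ K k)⁻¹ := inv_nonneg.mpr (Real.sqrt_nonneg _)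
  fin_cases a <;> fin_cases b
  · simp only [nambuPropagatorCT, hden, Fin.zero_eta, Fin.isValue, Matrix.of_apply, Matrix.cons_val', Matrix.cons_val_zero,
      Matrix.empty_val', Matrix.cons_val_fin_one]
    rw [klFreqRadius, h00]
  · simp [nambuPropagatorCT]; exact (klFreqRadius_pos hβ μ K k).le
  · simp [nambuPropagatorCT]; exact (klFreqRadius_pos hβ μ K k).le
  · simp only [nambuPropagatorCT, hden, Fin.mk_one, Fin.isValue, Matrix.of_apply, Matrix.cons_val', Matrix.cons_val_one,
      Matrix.empty_val', Matrix.cons_val_fin_one]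
    rw [klFreqRadius, h11]

/-- **The zero-seed CT Nambu table entrywise**: `‖⟨Ψ̂⁻_{k,a} Ψ̂⁺_{k′,b}⟩‖ ≤ βL²/t(k)` (`β > 0`). -/
theorem klld_norm_nambuTwoPointCT_zero_seed_le {β : ℝ} (hβ : 0 < β) (μ : ℝ) (K : TrigPolyC4v)
    (X Y : (FreqMomentum L M × Fin 2) × Fin 2) :
    ‖nambuTwoPointCT L M β μ 0 K X Y‖ ≤ β * (L : ℝ) ^ 2 * (klFreqRadius L M β μ K X.1.1)⁻¹ := by
  have hβL : 0 ≤ β * (L : ℝ) ^ 2 := by positivity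
  have hinv : 0 ≤ (klFreqRadius L M β μ K X.1.1)⁻¹ := inv_nonneg.mpr (Real.sqrt_nonneg _)
  unfold nambuTwoPointCT
  split_ifs with hc
  · rw [norm_mul, Complex.norm_real, Real.norm_eq_abs, abs_of_nonneg hβL]
    exact mul_le_mul_of_nonneg_left (klld_norm_nambuPropagatorCT_zero_seed_le hβ.ne' μ K X.1.1 X.1.2 Y.1.2) hβL
  · rw [norm_zero]; exact mul_nonneg hβL hinv

/-- The same bound read at the SECOND label (the table is momentum-diagonal: nonzero only for `k = k′`). -/
theorem klld_norm_nambuTwoPointCT_zero_seed_le_snd {β : ℝ} (hβ : 0 < β) (μ : ℝ) (K : TrigPolyC4v)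
    (X Y : (FreqMomentum L M × Fin 2) × Fin 2) :
    ‖nambuTwoPointCT L M β μ 0 K X Y‖ ≤ β * (L : ℝ) ^ 2 * (klFreqRadius L M β μ K Y.1.1)⁻¹ := by
  have hβL : 0 ≤ β * (L : ℝ) ^ 2 := by positivity
  have hinv : 0 ≤ (klFreqRadius L M β μ K Y.1.1)⁻¹ := inv_nonneg.mpr (Real.sqrt_nonneg _)
  by_cases hc : X.2 = 1 ∧ Y.2 = 0 ∧ X.1.1 = Y.1.1
  · have h := klld_norm_nambuTwoPointCT_zero_seed_le hβ μ K X Y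
    rwa [hc.2.2] at h
  · have h0 : nambuTwoPointCT L M β μ 0 K X Y = 0 := by
      unfold nambuTwoPointCT; rw [if_neg hc]
    rw [h0, norm_zero]; exact mul_nonneg hβL hinv

/-- **The zero-seed CT two-point table entrywise, read at the first label**: `‖⟨ψ_X ψ_Y⟩₀^K‖ ≤ 2βL²/t(k_X)`. -/
theorem klld_norm_hubbardTwoPointCT_zero_seed_le [NeZero L] {β : ℝ} (hβ : 0 < β) (μ : ℝ) (K : TrigPolyC4v)
    (X Y : HubbardFieldIdx L M) :
    ‖hubbardTwoPointCT L M β μ 0 K X Y‖ ≤ 2 * (β * (L : ℝ) ^ 2) * (klFreqRadius L M β μ K (momentumOf L M X))⁻¹ := by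
  unfold hubbardTwoPointCT
  have h1 := klld_norm_nambuTwoPointCT_zero_seed_le hβ μ K (toNambu X) (toNambu Y)
  have h2 := klld_norm_nambuTwoPointCT_zero_seed_le_snd hβ μ K (toNambu Y) (toNambu X)
  rw [klFreqRadius_toNambu] at h1 h2
  have h := norm_sub_le (nambuTwoPointCT L M β μ 0 K (toNambu X) (toNambu Y)) (nambuTwoPointCT L M β μ 0 K (toNambu Y) (toNambu X))
  rw [momentumOf]
  linarith

/-- **… and read at the second label**: `‖⟨ψ_X ψ_Y⟩₀^K‖ ≤ 2βL²/t(k_Y)`. -/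
theorem klld_norm_hubbardTwoPointCT_zero_seed_le_snd [NeZero L] {β : ℝ} (hβ : 0 < β) (μ : ℝ) (K : TrigPolyC4v)
    (X Y : HubbardFieldIdx L M) :
    ‖hubbardTwoPointCT L M β μ 0 K X Y‖ ≤ 2 * (β * (L : ℝ) ^ 2) * (klFreqRadius L M β μ K (momentumOf L M Y))⁻¹ := by
  rw [← norm_neg, ← hubbardTwoPointCT_swap]
  exact klld_norm_hubbardTwoPointCT_zero_seed_le hβ μ K Y X

/-! ## §3 The slice covariance entrywise -/

/-- **The zero-seed slice covariance, entrywise**: for `β > 0`, every frame `K`, all scales `Λ, Λ'` and all labels,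
`‖(C^K_{>Λ} − C^K_{>Λ'})(X, Y)‖ ≤ βL²·(|w_Λ(k_X) − w_{Λ'}(k_X)|/t(k_X) + |w_Λ(k_Y) − w_{Λ'}(k_Y)|/t(k_Y))`. -/
theorem klld_norm_covSliceCT_zero_seed_le [NeZero L] {β : ℝ} (hβ : 0 < β) (μ : ℝ) (K : TrigPolyC4v) (Λ Λ' : ℝ)
    (X Y : HubbardFieldIdx L M) :
    ‖hubbardCovSliceCT L M β μ 0 K Λ Λ' X Y‖ ≤
      β * (L : ℝ) ^ 2 *
        (|hubbardCutoffWeightCT L M β μ K Λ (momentumOf L M X) - hubbardCutoffWeightCT L M β μ K Λ' (momentumOf L M X)| *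
            (klFreqRadius L M β μ K (momentumOf L M X))⁻¹ +
          |hubbardCutoffWeightCT L M β μ K Λ (momentumOf L M Y) - hubbardCutoffWeightCT L M β μ K Λ' (momentumOf L M Y)| *
            (klFreqRadius L M β μ K (momentumOf L M Y))⁻¹) := by
  set dX := hubbardCutoffWeightCT L M β μ K Λ (momentumOf L M X) - hubbardCutoffWeightCT L M β μ K Λ' (momentumOf L M X) with hdX
  set dY := hubbardCutoffWeightCT L M β μ K Λ (momentumOf L M Y) - hubbardCutoffWeightCT L M β μ K Λ' (momentumOf L M Y) with hdY
  set tX := klFreqRadius L M β μ K (momentumOf L M X) with htX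
  set tY := klFreqRadius L M β μ K (momentumOf L M Y) with htY
  set C := hubbardCovarianceCT L M β μ 0 K X Y with hC
  have hβL : 0 ≤ β * (L : ℝ) ^ 2 := by positivity
  have htX0 : 0 ≤ tX⁻¹ := inv_nonneg.mpr (Real.sqrt_nonneg _)
  have htY0 : 0 ≤ tY⁻¹ := inv_nonneg.mpr (Real.sqrt_nonneg _)
  -- the entry is `((dX + dY)/2) • C`
  have hentry : hubbardCovSliceCT L M β μ 0 K Λ Λ' X Y = (((dX + dY) / 2 : ℝ) : ℂ) * C := by
    simp only [hubbardCovSliceCT, hubbardCovAboveCT, Matrix.sub_apply, Matrix.of_apply, hdX, hdY, hC]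
    push_cast
    ring
  -- `‖C‖` read at either label
  have hCX : ‖C‖ ≤ 2 * (β * (L : ℝ) ^ 2) * tX⁻¹ := by
    rw [hC, hubbardCovarianceCT, Matrix.of_apply, norm_neg]
    exact klld_norm_hubbardTwoPointCT_zero_seed_le hβ μ K X Y
  have hCY : ‖C‖ ≤ 2 * (β * (L : ℝ) ^ 2) * tY⁻¹ := by
    rw [hC, hubbardCovarianceCT, Matrix.of_apply, norm_neg]
    exact klld_norm_hubbardTwoPointCT_zero_seed_le_snd hβ μ K X Y
  rw [hentry, norm_mul, Complex.norm_real, Real.norm_eq_abs]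
  have habs : |(dX + dY) / 2| ≤ (|dX| + |dY|) / 2 := by
    rw [abs_div, abs_of_pos (by norm_num : (0:ℝ) < 2)]
    exact div_le_div_of_nonneg_right (abs_add_le dX dY) (by norm_num)
  calc |(dX + dY) / 2| * ‖C‖ ≤ (|dX| + |dY|) / 2 * ‖C‖ := mul_le_mul_of_nonneg_right habs (norm_nonneg _)
    _ = |dX| / 2 * ‖C‖ + |dY| / 2 * ‖C‖ := by ring
    _ ≤ |dX| / 2 * (2 * (β * (L : ℝ) ^ 2) * tX⁻¹) + |dY| / 2 * (2 * (β * (L : ℝ) ^ 2) * tY⁻¹) := by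
        gcongr
    _ = β * (L : ℝ) ^ 2 * (|dX| * tX⁻¹ + |dY| * tY⁻¹) := by ring

/-- One slice of the weight, between the KL scales `Λ_n` and `Λ_{n−1}`, at any label: `|Δw_n(k)|/t(k) ≤ 2/Λ_n` (the weights lie in `[0,1]`;
where they differ, `1/t < 2/Λ_n` by `klld_inv_lt_of_slice_ne`; where they agree the left side is `0`). -/
theorem klld_abs_sliceWeight_div_radius_le (β μ : ℝ) (K : TrigPolyC4v) (n : ℕ) (k : FreqMomentum L M) :
    |hubbardCutoffWeightCT L M β μ K (klScale klE0 n) k - hubbardCutoffWeightCT L M β μ K (klScale klE0 (n - 1)) k| *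
        (klFreqRadius L M β μ K k)⁻¹ ≤ 2 / klScale klE0 n := by
  have hΛ := klth_klScale_pos n
  by_cases h : hubbardCutoffWeightCT L M β μ K (klScale klE0 n) k = hubbardCutoffWeightCT L M β μ K (klScale klE0 (n - 1)) k
  · rw [h, sub_self, abs_zero, zero_mul]; positivity
  · have hw1 := salmhoferCutoff_mem_Icc ((matsubaraFreq β M k.1 ^ 2 + nambuXiCT L μ K k.2 ^ 2) / klScale klE0 n ^ 2)
    have hw2 := salmhoferCutoff_mem_Icc ((matsubaraFreq β M k.1 ^ 2 + nambuXiCT L μ K k.2 ^ 2) / klScale klE0 (n - 1) ^ 2)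
    have habs : |hubbardCutoffWeightCT L M β μ K (klScale klE0 n) k -
        hubbardCutoffWeightCT L M β μ K (klScale klE0 (n - 1)) k| ≤ 1 := by
      simp only [hubbardCutoffWeightCT] at *
      rw [abs_le]; constructor <;> linarith [hw1.1, hw1.2, hw2.1, hw2.2]
    rw [klld_weight_eq_salmhofer_radius, klld_weight_eq_salmhofer_radius] at h
    have hlt := klld_inv_lt_of_slice_ne (sq_nonneg _) h
    have h0 : 0 ≤ klFreqRadius L M β μ K k := Real.sqrt_nonneg _
    rw [Real.sqrt_sq h0] at hlt
    have hinv : 0 ≤ (klFreqRadius L M β μ K k)⁻¹ := inv_nonneg.mpr (Real.sqrt_nonneg _)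
    calc _ ≤ 1 * (klFreqRadius L M β μ K k)⁻¹ := mul_le_mul_of_nonneg_right habs hinv
      _ ≤ 2 / klScale klE0 n := by rw [one_mul]; exact hlt.le

/-- **The single-slice covariance of the KL ladder, entrywise**: `‖(C^K_{>Λ_n} − C^K_{>Λ_{n−1}})(X, Y)‖ ≤ 4βL²/Λ_n` for every frame, every
`β > 0`, all `μ, M, L` and all labels — and the entry VANISHES unless the weight of `X` or of `Y` changes between the two scales
(`klld_covSliceCT_apply_eq_zero`), i.e. (at `±ω₀`) unless one of the two legs is counted by `legSliceCountT … n` (`klld_counted_of_weight_ne`). -/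
theorem klld_norm_covSliceCT_klScale_le [NeZero L] {β : ℝ} (hβ : 0 < β) (μ : ℝ) (K : TrigPolyC4v) (n : ℕ)
    (X Y : HubbardFieldIdx L M) :
    ‖hubbardCovSliceCT L M β μ 0 K (klScale klE0 n) (klScale klE0 (n - 1)) X Y‖ ≤ 4 * (β * (L : ℝ) ^ 2) / klScale klE0 n := by
  have h := klld_norm_covSliceCT_zero_seed_le hβ μ K (klScale klE0 n) (klScale klE0 (n - 1)) X Y
  have hX := klld_abs_sliceWeight_div_radius_le β μ K n (momentumOf L M X)
  have hY := klld_abs_sliceWeight_div_radius_le β μ K n (momentumOf L M Y)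
  have hβL : 0 ≤ β * (L : ℝ) ^ 2 := by positivity
  have hΛ := klth_klScale_pos n
  calc _ ≤ β * (L : ℝ) ^ 2 * (2 / klScale klE0 n + 2 / klScale klE0 n) := h.trans (by gcongr)
    _ = 4 * (β * (L : ℝ) ^ 2) / klScale klE0 n := by ring

/-- **On one mode at the reading frequency** (both labels of the dressed leg `(ω₀, k⃗, σ)`): the slice entry has norm
`≤ 2βL²·|Δw_n(k⃗)|/t(k⃗)` with `t = klLegRadius` — zero off the counted window, `< 4βL²/Λ_n` on it. -/
theorem klld_norm_covSliceCT_mode_omega0_le [NeZero L] [NeZero M] {β : ℝ} (hβ : 0 < β) (μ : ℝ) (K : TrigPolyC4v) (Λ Λ' : ℝ)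
    (k : TorusSite 2 L) (σ : Fin 2) (c c' : Fin 2) :
    ‖hubbardCovSliceCT L M β μ 0 K Λ Λ' (((omega0 M, k), σ), c) (((omega0 M, k), σ), c')‖ ≤
      2 * (β * (L : ℝ) ^ 2) *
        (|hubbardCutoffWeightCT L M β μ K Λ (omega0 M, k) - hubbardCutoffWeightCT L M β μ K Λ' (omega0 M, k)| *
          (klLegRadius L β μ K k)⁻¹) := by
  have h := klld_norm_covSliceCT_zero_seed_le hβ μ K Λ Λ' (((omega0 M, k), σ), c) (((omega0 M, k), σ), c')
  simp only [momentumOf, klFreqRadius_omega0] at h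
  linarith

end Model

end Summit.HubbardSuperconductivity.HubbardSuperconductivity.Theorems.KLRegimeSplit

end
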